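import Literature.NumberTheory.LFunctions.LevinsonGammaFactor
import Literature.NumberTheory.LFunctions.ConreyAuxiliaryQ
import Literature.NumberTheory.LFunctions.ZetaZerosOffLine
import Literature.NumberTheory.LFunctions.ZeroCountingDerivZetaProofs
import HarnessLib

/-!
# Levinson's method, first step (Conrey 1983, §4 (1)–(3)) for `ζ`: `N₀(T₂) − N₀(T₁) ≥ N(T₂) − N(T₁) − 2N_V − (boundary terms)`

Topic `Literature/NumberTheory/LFunctions`. Proofs only. The structural half of the first step of
Levinson's method in Conrey's arrangement (J. B. Conrey, *J. Number Theory* 16 (1983), §4,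
(1)–(3)), for the Riemann zeta function and Conrey's exact auxiliary function
`V = conreyV φ L` (`ConreyAuxiliaryQ.lean`: `Q = Γℝ · V`, `c·Λ = Q + Q♯`):

  **`N₀(T₂) − N₀(T₁) ≥ N(T₂) − N(T₁) − (S(T₂) − S(T₁)) + (1/π)·B_V − 2 N_V − 1`**
  (`levinsonConrey_criticalZeroCount_ge`),

where `N₀`, `N` are the tree's counting functions of the critical and of all zeros
(`Literature.NumberTheory.LFunctions.criticalZeroCount`, `Literature.NumberTheory.LFunctions.zetaZeroCount`, with
multiplicity), `S` is `Literature.NumberTheory.LFunctions.zetaArgS` (`= O(log T)`,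
`Literature.NumberTheory.LFunctions.abs_zetaArgS_le`), `B_V = Im ∫_{½}^{b} (V'/V)(x+iT₁) dx − Im ∫_{½}^{b} (V'/V)(x+iT₂) dx
+ ∫_{T₁}^{T₂} Re (V'/V)(b+it) dt` are the boundary terms of `V` on the three edges of
`R = [½, b] × [T₁, T₂]` other than the critical segment, and `N_V` is the number of zeros of `V` in
`R°` (with multiplicity). The hypotheses are those under which the printed argument is run: `φ` real
with `φ(x) + φ(1−x) = c ≠ 0`, `½ < b < 3`, `0 < T₁ < T₂`, and `V ≠ 0` on the three edges.

What remains of Conrey's (3)–(4) after this file is analytic: `B_V = O(log T₂)` (Jensen/Backlund on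
the horizontal edges, `V → 1` on `σ = b`), and the bound for `N_V` by Littlewood's lemma applied to
the mollified `ψ V` (`Literature.NumberTheory.LFunctions.littlewood_count_le_of_meanSquare`) together with
the mollified mean square — the latter being the substance of Levinson 1974 / Conrey 1989 /
Pratt–Robles–Zaharescu–Zeindler 2020 (the named fact `Literature.NumberTheory.LFunctions.przz_bound`).

Proof: `Literature.NumberTheory.LFunctions.levinsonConrey_zeroDetection_Gammaℝ_mul` (generic in `V`)
bounds from below the multiplicities of the zeros of `Ξ = ΓℝV + (ΓℝV)♯` on the segment; near the
segment `Ξ = conreyQ + conreyQ♯ = c Γℝ ζ` (`Literature.NumberTheory.LFunctions.conreyQ_add_conj_one_sub_conj_eq`),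
so these zeros are critical zeros of `ζ` with the same multiplicities, whose sum over distinct
ordinates in `(T₁, T₂)` is at most `N₀(T₂) − N₀(T₁)`.

## References

* J. B. Conrey, *Zeros of derivatives of Riemann's ξ-function on the critical line*, J. Number
  Theory 16 (1983), 49–74, §4 (1)–(3). [Conrey1983]
* N. Levinson, Adv. Math. 13 (1974), 383–436, §1–2; E. C. Titchmarsh, *The Theory of the Riemann
  Zeta-Function*, 2nd ed. (1986), §10.28.
-/

noncomputable section

open Complex Set MeasureTheory Filter Topology intervalIntegral Polynomial
open scoped Real ComplexConjugate

namespace Literature.NumberTheory.LFunctions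

open Literature.Analysis.Complex Literature.NumberTheory.DiophantineGeometry

/-- For `ρ ≠ 1`, the multiplicity `m(ρ) = riemannZetaZeroOrder ρ` is the analytic order of `ζ` at
`ρ`, read in `ℕ`. [folklore] -/
theorem riemannZetaZeroOrder_eq_toNat {ρ : ℂ} (h : ρ ≠ 1) :
    riemannZetaZeroOrder ρ = ((analyticOrderAt riemannZeta ρ).toNat : ℤ) := by
  have ha : AnalyticAt ℂ riemannZeta ρ := analyticOn_riemannZeta ρ h
  rw [riemannZetaZeroOrder, ha.meromorphicOrderAt_eq,
    ← Nat.cast_analyticOrderNatAt (analyticOrderAt_riemannZeta_ne_top h)]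
  simp

/-- **Levinson's method, first step, for `ζ`** (Conrey 1983, §4 (1)–(3), structural form). Let `φ`
be a real polynomial with `φ + φ∘(1−X) = c`, `c ≠ 0`, let `½ < b < 3`, `0 < T₁ < T₂`, `L` real, and
suppose Conrey's `V = conreyV φ L` does not vanish on the bottom, top and right edges of
`R = [½, b] × [T₁, T₂]`. Then
`N₀(T₂) − N₀(T₁) ≥ N(T₂) − N(T₁) − (S(T₂) − S(T₁)) + (1/π)(Im ∫_{½}^{b} (V'/V)(x+iT₁) dx`
`  − Im ∫_{½}^{b} (V'/V)(x+iT₂) dx + ∫_{T₁}^{T₂} Re (V'/V)(b+it) dt) − 2 N_V − 1`,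
`N_V = Σ_{ρ ∈ R°, V(ρ)=0} m_V(ρ)`. [cite: Conrey1983, §4 (1)–(3)] -/
theorem levinsonConrey_criticalZeroCount_ge {φ : ℝ[X]} {c : ℝ} (hφ : φ + φ.comp (1 - X) = C c)
    (hc : c ≠ 0) (L : ℝ) {b T₁ T₂ : ℝ} (hb : (1 / 2 : ℝ) < b) (hb3 : b < 3) (hT₁ : 0 < T₁) (hT : T₁ < T₂)
    (h_bot : ∀ x ∈ Icc (1 / 2 : ℝ) b, conreyV φ L (x + T₁ * I) ≠ 0)
    (h_top : ∀ x ∈ Icc (1 / 2 : ℝ) b, conreyV φ L (x + T₂ * I) ≠ 0)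
    (h_right : ∀ y ∈ Icc T₁ T₂, conreyV φ L (b + y * I) ≠ 0) :
    ((zetaZeroCount T₂ : ℝ) - zetaZeroCount T₁) - (zetaArgS T₂ - zetaArgS T₁) +
        ((∫ x in (1 / 2 : ℝ)..b, deriv (conreyV φ L) (x + T₁ * I) / conreyV φ L (x + T₁ * I)).im -
          (∫ x in (1 / 2 : ℝ)..b, deriv (conreyV φ L) (x + T₂ * I) / conreyV φ L (x + T₂ * I)).im +
          (∫ y in T₁..T₂, (deriv (conreyV φ L) (b + y * I) / conreyV φ L (b + y * I)).re)) / π -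
        2 * ∑ᶠ ρ ∈ {ρ : ℂ | conreyV φ L ρ = 0 ∧ ρ ∈ Ioo (1 / 2 : ℝ) b ×ℂ Ioo T₁ T₂},
          ((meromorphicOrderAt (conreyV φ L) ρ).untop₀ : ℝ) - 1 ≤
      (criticalZeroCount T₂ : ℝ) - criticalZeroCount T₁ := by
  set V : ℂ → ℂ := conreyV φ L with hV_def
  set Ξ : ℂ → ℂ := fun s : ℂ ↦ Gammaℝ s * V s +
    conj (Gammaℝ ((2 * (1 / 2 : ℝ) : ℂ) - conj s) * V ((2 * (1 / 2 : ℝ) : ℂ) - conj s)) with hΞ_def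
  have hVan : AnalyticOnNhd ℂ V (Icc (1 / 2 : ℝ) b ×ℂ Icc T₁ T₂) := analyticOnNhd_conreyV_rect φ L hb3 hT₁
  have htwo : ((2 * (1 / 2 : ℝ) : ℂ)) = 1 := by push_cast; ring
  -- near the critical segment, `Ξ = c Γℝ ζ`
  have hΞ_eq : ∀ s : ℂ, 0 < s.re → s.re < 1 → 0 < s.im → Ξ s = (c * Gammaℝ s) * riemannZeta s := by
    intro s h0 h1 him
    have hs1 : s ≠ 1 := by rintro rfl; simp at him
    have hw : 0 < (1 - conj s).re := by simp; linarith
    have h := conreyQ_add_conj_one_sub_conj_eq hφ L h0 (by linarith) hs1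
    rw [conreyQ_eq_Gammaℝ_mul_conreyV φ L h0, conreyQ_eq_Gammaℝ_mul_conreyV φ L hw] at h
    simp only [hΞ_def, htwo]
    rw [h]
    ring
  have hU : IsOpen {s : ℂ | 0 < s.re ∧ s.re < 1 ∧ 0 < s.im} :=
    ((isOpen_lt continuous_const continuous_re).inter
      ((isOpen_lt continuous_re continuous_const).inter (isOpen_lt continuous_const continuous_im)))
  have hseg : ∀ t ∈ Ioo T₁ T₂, (((1 / 2 : ℝ) : ℂ) + t * I) ∈ {s : ℂ | 0 < s.re ∧ s.re < 1 ∧ 0 < s.im} := by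
    intro t ht
    refine ⟨by simp, by simp; norm_num, by simp; linarith [ht.1]⟩
  have hΞ_ev : ∀ t ∈ Ioo T₁ T₂, Ξ =ᶠ[𝓝 (((1 / 2 : ℝ) : ℂ) + t * I)]
      fun s ↦ (c * Gammaℝ s) * riemannZeta s := by
    intro t ht
    filter_upwards [hU.mem_nhds (hseg t ht)] with s hs
    exact hΞ_eq s hs.1 hs.2.1 hs.2.2
  -- the order of `Ξ` at a point of the segment is the multiplicity of `ζ`
  have horder : ∀ t ∈ Ioo T₁ T₂,
      analyticOrderAt Ξ (((1 / 2 : ℝ) : ℂ) + t * I) = analyticOrderAt riemannZeta (((1 / 2 : ℝ) : ℂ) + t * I) := by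
    intro t ht
    set ρ : ℂ := ((1 / 2 : ℝ) : ℂ) + t * I with hρ
    have hρre : 0 < ρ.re := by simp [hρ]
    have hρ1 : ρ ≠ 1 := by
      intro h; have := congrArg Complex.im h; simp [hρ] at this; linarith [ht.1]
    have hg : AnalyticAt ℂ (fun s ↦ (c : ℂ) * Gammaℝ s) ρ := analyticAt_const.mul (analyticAt_Gammaℝ_of_re_pos hρre)
    have hg0 : (c : ℂ) * Gammaℝ ρ ≠ 0 := mul_ne_zero (by exact_mod_cast hc) (Gammaℝ_ne_zero_of_re_pos hρre)
    have hζ : AnalyticAt ℂ riemannZeta ρ := analyticOn_riemannZeta ρ hρ1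
    rw [analyticOrderAt_congr (hΞ_ev t ht)]
    change analyticOrderAt ((fun s ↦ (c : ℂ) * Gammaℝ s) * riemannZeta) ρ = _
    rw [analyticOrderAt_mul hg hζ, hg.analyticOrderAt_eq_zero.2 hg0, zero_add]
  have hfin : ∀ t ∈ Ioo T₁ T₂, analyticOrderAt Ξ (((1 / 2 : ℝ) : ℂ) + t * I) ≠ ⊤ := by
    intro t ht
    rw [horder t ht]
    refine analyticOrderAt_riemannZeta_ne_top ?_
    intro h; have := congrArg Complex.im h; simp at this; linarith [ht.1]
  -- the generic zero detection
  obtain ⟨Z, hZsub, hZ0, hcnt⟩ :=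
    levinsonConrey_zeroDetection_Gammaℝ_mul hb hT hVan h_bot h_top h_right hfin
  refine hcnt.trans ?_
  -- the points `½ + it`, `t ∈ Z`, are distinct critical zeros of `ζ` with `T₁ < t ≤ T₂`
  have hZzero : ∀ t ∈ Z, riemannZeta (((1 / 2 : ℝ) : ℂ) + t * I) = 0 := by
    intro t ht
    have htI := hZsub (Finset.mem_coe.2 ht)
    have h := hZ0 t ht
    have hρre : 0 < (((1 / 2 : ℝ) : ℂ) + t * I).re := by simp
    have e : Ξ (((1 / 2 : ℝ) : ℂ) + t * I) = 0 := h
    rw [hΞ_eq _ (hseg t htI).1 (hseg t htI).2.1 (hseg t htI).2.2] at e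
    exact (mul_eq_zero.1 e).resolve_left
      (mul_ne_zero (by exact_mod_cast hc) (Gammaℝ_ne_zero_of_re_pos hρre))
  -- rewrite the multiplicities
  have hsumZ : ∑ t ∈ Z, ((analyticOrderAt Ξ (((1 / 2 : ℝ) : ℂ) + t * I)).toNat : ℝ) =
      ∑ t ∈ Z, (riemannZetaZeroOrder (((1 / 2 : ℝ) : ℂ) + t * I) : ℝ) := by
    refine Finset.sum_congr rfl fun t ht ↦ ?_
    have htI := hZsub (Finset.mem_coe.2 ht)
    have hρ1 : (((1 / 2 : ℝ) : ℂ) + t * I) ≠ 1 := by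
      intro h; have := congrArg Complex.im h; simp at this; linarith [htI.1]
    rw [horder t htI, riemannZetaZeroOrder_eq_toNat hρ1]
    simp
  rw [hsumZ]
  -- compare with `N₀(T₂) − N₀(T₁)` as a finsum over the critical zeros with `T₁ < Im ρ ≤ T₂`
  set C : ℝ → Set ℂ := fun T ↦ {ρ ∈ zetaZeroBox 0 T | ρ.re = 1 / 2} with hC
  have hCsub : C T₁ ⊆ C T₂ := by
    rintro ρ ⟨⟨h0, h1, h2, h3, h4⟩, h5⟩
    exact ⟨⟨h0, h1, h2, h3, h4.trans hT.le⟩, h5⟩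
  have hCfin : (C T₂).Finite := (zetaZeroBox_finite 0 T₂).subset (sep_subset _ _)
  have hN₀ : ((criticalZeroCount T₂ : ℝ) - criticalZeroCount T₁) =
      ((∑ᶠ ρ ∈ C T₂ \ C T₁, riemannZetaZeroOrder ρ : ℤ) : ℝ) := by
    have h1 := natCast_criticalZeroCount T₁
    have h2 := natCast_criticalZeroCount T₂
    have hsplit : ∑ᶠ ρ ∈ C T₂, riemannZetaZeroOrder ρ =
        ∑ᶠ ρ ∈ C T₁, riemannZetaZeroOrder ρ + ∑ᶠ ρ ∈ C T₂ \ C T₁, riemannZetaZeroOrder ρ := by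
      conv_lhs => rw [← Set.union_sdiff_cancel hCsub]
      exact finsum_mem_union disjoint_sdiff_right (hCfin.subset hCsub) (hCfin.subset Set.sdiff_subset)
    have e : ((criticalZeroCount T₂ : ℤ) - criticalZeroCount T₁ : ℤ) = ∑ᶠ ρ ∈ C T₂ \ C T₁, riemannZetaZeroOrder ρ := by
      rw [h1, h2, hsplit]; ring
    have e' := congrArg (fun z : ℤ ↦ (z : ℝ)) e
    push_cast at e'
    exact e'
  -- the image of `Z`
  set A : Set ℂ := (fun t : ℝ ↦ ((1 / 2 : ℝ) : ℂ) + t * I) '' (↑Z : Set ℝ) with hA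
  have hinj : Set.InjOn (fun t : ℝ ↦ ((1 / 2 : ℝ) : ℂ) + t * I) (↑Z : Set ℝ) := by
    intro t _ t' _ h
    have := congrArg Complex.im h
    simpa using this
  have hAsub : A ⊆ C T₂ \ C T₁ := by
    rintro ρ ⟨t, ht, rfl⟩
    have htI := hZsub ht
    refine ⟨⟨⟨hZzero t ht, by simp, by simp; norm_num, by simp; linarith [htI.1], by simp; exact htI.2.le⟩,
      by simp⟩, ?_⟩
    rintro ⟨⟨-, -, -, -, h4⟩, -⟩
    simp at h4
    linarith [htI.1]
  have hmono := finsum_riemannZetaZeroOrder_mono (hCfin.subset Set.sdiff_subset) hAsub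
    (fun ρ hρ ↦ riemannZetaZeroOrder_pos_of_mem_zetaZeroBox hρ.1.1)
  have hsumA : ∑ᶠ ρ ∈ A, riemannZetaZeroOrder ρ = ∑ t ∈ Z, riemannZetaZeroOrder (((1 / 2 : ℝ) : ℂ) + t * I) := by
    rw [hA, finsum_mem_image hinj, finsum_mem_coe_finset]
  rw [hN₀]
  have h := hmono
  rw [hsumA] at h
  have h' : ((∑ t ∈ Z, riemannZetaZeroOrder (((1 / 2 : ℝ) : ℂ) + t * I) : ℤ) : ℝ) ≤
      ((∑ᶠ ρ ∈ C T₂ \ C T₁, riemannZetaZeroOrder ρ : ℤ) : ℝ) := by exact_mod_cast h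
  rw [Int.cast_sum] at h'
  exact h'

end Literature.NumberTheory.LFunctions

end
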